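import Mathlib
import HarnessLib
import Summits.AnomalousDissipation.AnomalousDissipation.Theses.DyadicWallCascade
import Summits.AnomalousDissipation.AnomalousDissipation.Theorems.DyadicWallCascadeViscousContinuationStubFluxNeg

/-!
# Stub `stub_seedIffHierarchy` of line `Sketch` — crux stmt-AnomalousDissipation-17917 (`ViscousContinuation`)

This file proves the registered stub `stub_seedIffHierarchy` of line `Sketch` of the crux
stmt-AnomalousDissipation-17917 (`DyadicWallCascade.ViscousContinuation`): the seed normalisation
certificate.  The flux-normalised seed — a half-space hierarchy `(V, Q, C, F)` (bounded smooth steady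
Euler flow on `{z > 0}`, divergence free, degree-0 dilation invariant, band-periodic, zero mass flux
through the unit square at `z = 1`) with NEGATIVE energy flux `F < 0` — is EQUIVALENT to the route
decl `HalfSpaceHierarchy` (the same ten clauses with `F ≠ 0`).

* `→` is trivial: `F < 0 ⇒ F ≠ 0` (`LT.lt.ne`), and the inlined clause block is the route decl's
  `let`-block by `rfl` (`X ∈ {X | 0 < X 2}` unfolds to `0 < X 2`).
* `←` is the landed sibling stub `stub_fluxNeg` (steady Euler is `V ↦ −V` symmetric with the same
  pressure, so the sign of `F` may be taken negative without loss of generality), used via import.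
-/

-- `Summit.<Summit>.<Problem>`: single-conjunct summit, the duplicate namespace is mandated (CONVENTIONS §2).
set_option linter.dupNamespace false

noncomputable section

namespace Summit.AnomalousDissipation.AnomalousDissipation.Theorems

open MeasureTheory
open Summit.AnomalousDissipation.AnomalousDissipation.Theses.DyadicWallCascade

/-- Euclidean 3-space (local notation, as in the registered skeleton). -/
local notation "E³" => EuclideanSpace ℝ (Fin 3)

/-- **Seed normalisation certificate** (registered stub `stub_seedIffHierarchy` of line `Sketch`,
crux stmt-AnomalousDissipation-17917).  The flux-normalised seed (a half-space hierarchy with energy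
flux `F < 0`) is equivalent to the route decl `HalfSpaceHierarchy` (energy flux `F ≠ 0`):
`→` since `F < 0 ⇒ F ≠ 0` and the clause blocks agree definitionally; `←` is the landed
`stub_fluxNeg` (`V ↦ −V`, same pressure, flips the sign of `F`). [folklore] -/
theorem stub_seedIffHierarchy :
    (∃ (V : E³ → E³) (Q : E³ → ℝ) (C F : ℝ),
        ContDiffOn ℝ ((⊤ : ℕ∞) : WithTop ℕ∞) V {X : E³ | 0 < X 2} ∧
        ContDiffOn ℝ ((⊤ : ℕ∞) : WithTop ℕ∞) Q {X : E³ | 0 < X 2} ∧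
        (∀ X : E³, 0 < X 2 → ‖V X‖ ≤ C ∧ |Q X| ≤ C) ∧
        (∀ X : E³, 0 < X 2 → ∑ i : Fin 3, (fderiv ℝ V X (EuclideanSpace.single i (1 : ℝ))) i = 0) ∧
        (∀ X : E³, 0 < X 2 → (fderiv ℝ V X) (V X) + gradient Q X = 0) ∧
        (∀ X : E³, 0 < X 2 → V ((2 : ℝ) • X) = V X ∧ Q ((2 : ℝ) • X) = Q X) ∧
        (∀ X : E³, 1 ≤ X 2 → X 2 ≤ 2 →
          V (X + EuclideanSpace.single 0 (1 : ℝ)) = V X ∧ V (X + EuclideanSpace.single 1 (1 : ℝ)) = V X ∧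
          Q (X + EuclideanSpace.single 0 (1 : ℝ)) = Q X ∧ Q (X + EuclideanSpace.single 1 (1 : ℝ)) = Q X) ∧
        (∫ q in Set.Icc (0 : ℝ) 1 ×ˢ Set.Icc (0 : ℝ) 1, (V !₂[q.1, q.2, (1 : ℝ)]) 2 = 0) ∧
        F < 0 ∧
        (∫ q in Set.Icc (0 : ℝ) 1 ×ˢ Set.Icc (0 : ℝ) 1,
          (V !₂[q.1, q.2, (1 : ℝ)]) 2 * (‖V !₂[q.1, q.2, (1 : ℝ)]‖ ^ 2 / 2 + Q !₂[q.1, q.2, (1 : ℝ)]) = F)) ↔ HalfSpaceHierarchy := by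
  refine ⟨?_, stub_fluxNeg⟩
  rintro ⟨V, Q, C, F, h1, h2, h3, h4, h5, h6, h7, h8, hF, h10⟩
  exact ⟨V, Q, C, F, h1, h2, h3, h4, h5, h6, h7, h8, hF.ne, h10⟩

end Summit.AnomalousDissipation.AnomalousDissipation.Theorems
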